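import Summits.ResolutionOfSingularities.ResolutionOfSingularities.Theorems.WallTransport
import HarnessLib

/-!
# WallTransport2 — decomp-res node «WallCut» (lens-4 g30, critic rows 176/176a CLEARED DECIDED +1), tree file 4/8 of the node

Content VERBATIM from the decomp-res lens-4 g30 node `HOME/decomp-res-lens-4/g30/WallCut.lean` (pin c43ccc48;
imports the landed tree only, carries nothing);
HOME = run/shared/lean/pub/decomp-res; critic rows 176/176a CLEARED DECIDED +1; landing orders INBOX :819 —
provenance, critic text and the lens header in full in the first file of the
node, `WallAlgebra`.  Namespace `…Theorems.HugValuationCut`; `--supports stmt-ResolutionOfSingularities-28338`.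

## This file

Continuation 2/2 of `WallTransport` (same section of the node, cut at the 400-line cap): carries `twoWall_point_dichotomy`.

[WRITER NOTE (decomp-res writer g11): file split only (tree files ≤ 400 lines); namespace, universes, sections,
section variables and every declaration
exactly as in the lens (the node's global dupNamespace-linter line is dropped — the library sets it; the `open
…Theses` line lives only in the Theses-cone file;
`set_option maxHeartbeats … in` prefixes of single declarations are kept VERBATIM).  ONE deletion (gate dedup rule,
critic :835 watch-list): the node's private copy of
isUnit_add_of_mem_maximalIdeal` is NOT re-landed — it is LITERALLY the landed
`Literature.AlgebraicGeometry.Resolution.isUnit_add_of_mem_maximalIdeal` (`WeightedInitialTerms`,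
imported; the namespace is opened as in the lens), which the transport proofs now cite by the same short name.
SECOND deletion (gate dedup bounce p810318):
the node's `range_triple` is NOT re-landed — it is LITERALLY the landed
`…Cruxes.HypersurfaceCentreConstruction.LocalEngine.Iota3.range_vec₃`
(`Theorems/WeightedInvariantIota3FlagTools`, imported from `WallAlgebra2` on; aliased by an explicit `open …
(range_vec₃)`), cited by name at its two uses.]

(Sources: Hauser2010Kangaroo (arXiv:0811.4151, Kangaroo Theorem condition (3)); HauserPerlega2019 §2; Hauser2024
PRIMS 60; Moh1987; Perlega2023; Matsumura1987 Thms. 14.2–14.3, 19.x; ZariskiSamuel1960 VIII §11; StacksProject Tags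
0804, 0BIQ, 00NQ, 0AGS; DeJong1996 2.4; CossartPiltant2008 §2; Giraud1975.)
-/

noncomputable section

open CategoryTheory AlgebraicGeometry IsLocalRing
open Literature.AlgebraicGeometry.Resolution
open Summit.ResolutionOfSingularities.ResolutionOfSingularities.Theorems
open WeakOrderReduction ForcedTowerClasses DivergentTowerClasses MonomialTowerClasses
open HugDimensionClasses HugDimensionKernels SurfaceShadowClasses SurfaceShadowKernels
open NearPointCut (SingularClass)
open scoped BigOperators
open Summit.ResolutionOfSingularities.ResolutionOfSingularities.Cruxes.HypersurfaceCentreConstruction.LocalEngine.Iota3 (range_vec₃)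

namespace Summit.ResolutionOfSingularities.ResolutionOfSingularities.Theorems.HugValuationCut

section WallTransport

variable {X X' : Scheme.{0}} {π : X' ⟶ X} {C : X.IdealSheafData}

/-- **THE WALL DICHOTOMY THROUGH ONE POINT BLOW-UP (KERNEL, PROVED; characteristic 2, weight 2, ring dimension ≤ 3 upstairs)** —
transport + exit: from a two-wall stage of wall exponent `e`, a marked class successor EITHER lies on the kept wall,
with `e ≥ 2`
and the two-wall presentation of exponent `e − 1` (the clock ticks), OR `e = 1` and it lies on NEITHER wall (the clock has run
out and the tower leaves both walls).  [folklore] -/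
theorem twoWall_point_dichotomy (hπ : IsBlowup π C) [IsLocallyNoetherian X] [IsLocallyNoetherian X']
    (hX : Scheme.IsRegular X) (hCreg : Scheme.IsRegular C.subscheme) (I W V H : X.IdealSheafData) {e : ℕ}
    (y : X') (hcl : IsClosed ({π y} : Set X)) (hpt : (C.support : Set X) = {π y})
    (hIn : stalkIdeal I (π y) ≤ maximalIdeal _ ^ 2)
    (hI'2 : stalkIdeal (controlledTransform π C I 2) y ≤ maximalIdeal _ ^ 2)
    (hdim : ¬ (4 : WithBot ℕ∞) ≤ ringKrullDim (X'.presheaf.stalk y))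
    [CharP (X'.presheaf.stalk y) 2] (hPP : PPowerFormAt 2 (controlledTransform π C I 2) 2 y)
    (h : TwoWallAt I W V H e (π y)) :
    (y ∈ (controlledTransform π C W 1).support ∧ 2 ≤ e ∧
        TwoWallAt (controlledTransform π C I 2) (controlledTransform π C W 1) (C.comap π)
          (controlledTransform π C H 1) (e - 1) y) ∨
      (e = 1 ∧ y ∉ (controlledTransform π C W 1).support ∧ y ∉ (controlledTransform π C V 1).support) := by
  by_cases hsat : y ∈ (controlledTransform π C W 1).support
  · exact Or.inl ⟨hsat, twoWall_point_transport hπ hX hCreg I W V H y hcl hpt hIn hI'2 hdim hPP h hsat⟩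
  · obtain ⟨h1, h2⟩ := twoWall_point_exit hπ hX hCreg I W V H y hcl hpt hIn hI'2 hPP h hsat
    exact Or.inr ⟨h1, hsat, h2⟩

end WallTransport

end Summit.ResolutionOfSingularities.ResolutionOfSingularities.Theorems.HugValuationCut
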